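import Summits.NavierStokesRegularity.NavierStokesRegularity.Theses.ConeTipCollapse

/-!
# Birth skeleton (BC3) for crux `ConeTipCollapse.ConeToResolver` (stmt-NavierStokesRegularity-19063)

planner-skel-stmt-NavierStokesRegularity-19063-0 · skeleton-register (BC3, one-shot) · 2026-08-17.
Route `route-NavierStokesRegularity-ConeTipCollapse` (rev 0, refutation route, `closes … : ¬ NavierStokesRegularity`),
crux #4 `ConeToResolver := InteractingLogPeriodicCone → CollapsingResolver` (rank 4, OPEN, difficulty
open-problem; binder of `closes`; wanted only by this route).

**THE CRUX.** If SOME interacting, chiral-octahedrally (O-)equivariant, `l₀`-log-periodic steady Euler cone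
`(h, P)` of degree `−a`, `1 < a < 3/2`, exists on `ℝ³ ∖ 0` (= `InteractingLogPeriodicCone`, crux #3), then SOME
such cone is the tangent flow at infinity of a `C^∞` O-equivariant steady Euler flow `(Q, Φ)` on `ℝ³` (nonzero on
every nonempty open set, conical tail `‖Q − h‖ + ‖y‖‖DQ − Dh‖ ≤ C‖y‖^(−a−δ)`) admitting a first-order collapse
corrector `(b < 0, W, q)`: `(Q·∇)W + (W·∇)Q + ∇q = ΔQ + b(aQ + (y·∇)Q)` (= `CollapsingResolver`, crux #2).

## The line — EQUIVARIANT DESINGULARISATION · COLLAPSE-COMPATIBLE SELECTION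

This types the route's own TWO-LAYER PLAN for this node ("ConeToResolver ⇐ stub_desing → stub_corrector")
through the one intermediate object the plan names, the RESOLVED SKELETON (an admissible cone together with a
smooth equivariant steady Euler flow on `ℝ³` having that cone as tangent flow at infinity):

* S1 `stub_desing` — RESOLVE ONLY (∀-form, the equivariant desingularisation theorem): EVERY admissible cone
  `(a, l₀, h, P)` (the eleven clauses of `InteractingLogPeriodicCone`, verbatim) is the tangent flow at infinity
  of some `C^∞`, divergence-free, steady Euler, O-equivariant `(Q, Φ)` on `ℝ³`, `Q` nonzero somewhere in every
  nonempty open set, with the conical tail estimate (the seven resolution clauses of `CollapsingResolver`,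
  verbatim). Engine named by the route: Voigt–MHD magnetic relaxation from the truncated cone
  (arXiv:2208.11109, Thms 1.1–1.2) made equivariant, whole-space and smooth.
* S2 `stub_corrector` — CORRECT BY SELECTION: whenever an admissible cone admits such a resolution `(Q, Φ)`,
  SOME admissible resolved skeleton admits a collapse corrector with `b < 0`, i.e. `CollapsingResolver` holds.
  This is the solvability-of-(★★) step of the plan in the form the route's own rationale requires: the
  solvability conditions of the corrector equation on the compact Bernoulli tori of `Q` (cokernel `f(B_Q)Q`,
  `g(B_Q) curl Q`; Arnold's structure theorem) are CONDITIONS ON `Q` (the per-torus energy/flux laws fix `b`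
  shell by shell), so the corrector exists only for a collapse-compatible resolution, which S2 must select (or
  build, re-using the desingularisation of S1 as a black box for existence); the "∀ resolution ∃ corrector"
  reading of CorrectOnly is deliberately NOT registered (it contradicts the rationale's own per-torus laws for a
  generic resolution and would be a dead stub on arrival).

Composition `ConeToResolver_of : S1 → S2 → ConeToResolver` (proved below, no sorry): the cone of
`InteractingLogPeriodicCone` is resolved by S1 and handed, with its resolution, to S2.

Costume / shredding self-check. S1 concludes an existence statement about steady Euler flows on `ℝ³` and never
mentions a corrector, `b`, or Navier–Stokes; S2 is `CollapsingResolver` under the EXTRA hypothesis "a resolved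
skeleton exists", which is strictly more than `InteractingLogPeriodicCone` (projection) — so S2 is implied by the
crux but gives it back only through S1 (no cheap `S2 → ConeToResolver`: a resolution cannot be conjured from a
bare cone; no cheap `S1 → ConeToResolver`: `W = q = 0` would need `ΔQ + b(aQ + (y·∇)Q) = 0`). Neither stub
mentions the summit. Not the refuted `AdiabaticEddy.CorrectorSolvable` (negatives stmt-1429: compact support ×
UCP): here `Q` vanishes on no open set and carries a conical tail, exactly the successor object (2b) of that kill
memo. BC3 probes (registrar's `bc/` folder, quoted in `Lines/birth.md`): `stub → ConeToResolver`,
`stub → NavierStokesRegularity`, `stub → ¬ NavierStokesRegularity` by `first | exact? | simpa | aesop` all FAIL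
for both stubs.
-/

-- the summit-side namespace `Summit.NavierStokesRegularity.NavierStokesRegularity.…` repeats a component by design (D-0017)
set_option linter.dupNamespace false

namespace Summit.NavierStokesRegularity.NavierStokesRegularity.Cruxes.ConeToResolver.Birth

open Summit.NavierStokesRegularity.NavierStokesRegularity.Theses.ConeTipCollapse

/-! ### The stubs S1–S2 (the ONLY `sorry`s of the file) -/

/-- **S1 `stub_desing` — RESOLVE ONLY: equivariant desingularisation of an admissible cone tip** (size XL; open
problem in kind). For all exponents `1 < a < 3/2`, ratios `l₀ > 1` and every `C¹` steady Euler cone `(h, P)` on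
`ℝ³ ∖ 0` that is `l₀`-discretely self-similar of degrees `(−a, −2a)`, divergence-free and steady Euler off `0`,
chiral-octahedrally equivariant (`h (g x) = g (h x)`, `P (g x) = P x` for the 24 signed-permutation rotations) and
interacting (every nonempty open set contains `x ≠ 0` with `h x ≠ 0`) — verbatim the clauses of
`InteractingLogPeriodicCone` — there is a `C^∞` steady Euler flow `(Q, Φ)` on `ℝ³` (`div Q = 0`,
`(Q·∇)Q + ∇Φ = 0`), O-equivariant, with `Q` nonzero somewhere in every nonempty open set, whose tangent flow at
infinity is the cone: `‖Q y − h y‖ + ‖y‖·‖DQ y − Dh y‖ ≤ C‖y‖^(−a−δ)` for `‖y‖ ≥ 1`, some `C`, some `δ > 0`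
(verbatim the resolution clauses of `CollapsingResolver`). Why plausibly true: the cone is a steady Euler flow
off the tip with locally finite energy (`a < 3/2`); truncating it smoothly near `0` and relaxing by the
(equivariance-preserving) Voigt–MHD flow conserves the far field and a weighted helicity and lands on a steady
Euler limit (arXiv:2208.11109 Thm 1.1/1.2 give such limits in `D((−Δ)^{α/2})` on `𝕋³` / bounded domains);
smoothing conical tips of steady states is unobstructed by the radial flux invariants (mass and Bernoulli fluxes
through spheres vanish identically by the DSS scaling `r^{2−a}`, `r^{2−3a}`). Why it might fail: anti-Grad — a
smooth NON-symmetric steady Euler flow with a region of compact invariant tori may not exist at all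
(arXiv:2007.09103 p.7 Conj. 1; arXiv:2305.05987 p.12: existence of rotational asymmetric homogeneous steady
flows "unknown"); relaxation limits are only `H^α`-regular and may vanish on open sets (arXiv:2208.11109 §5
example); the whole-space problem with a prescribed infinite-energy tail has no relaxation theory. Sources:
arXiv:2208.11109 (Thms 1.1, 1.2), arXiv:2007.09103 (Conj. 1), arXiv:2305.05987 (p.12), arXiv:1510.03378,
ArnoldKhesin1998 (Ch. II). -/
theorem stub_desing :
    ∀ (a l₀ : ℝ) (h : EuclideanSpace ℝ (Fin 3) → EuclideanSpace ℝ (Fin 3)) (P : EuclideanSpace ℝ (Fin 3) → ℝ), (1 < a ∧ a < 3 / 2 ∧ 1 < l₀ ∧ ContDiffOn ℝ 1 h {x : EuclideanSpace ℝ (Fin 3) | x ≠ 0} ∧ ContDiffOn ℝ 1 P {x : EuclideanSpace ℝ (Fin 3) | x ≠ 0} ∧ (∀ x : EuclideanSpace ℝ (Fin 3), x ≠ 0 → h (l₀ • x) = (l₀ ^ (-a)) • h x) ∧ (∀ x : EuclideanSpace ℝ (Fin 3), x ≠ 0 → P (l₀ • x) = l₀ ^ (-(2 * a)) * P x) ∧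 (∀ x : EuclideanSpace ℝ (Fin 3), x ≠ 0 → Literature.Analysis.FluidPDE.VectorCalculus.divergence h x = 0) ∧ (∀ x : EuclideanSpace ℝ (Fin 3), x ≠ 0 → Literature.Analysis.FluidPDE.convect h h x + gradient P x = 0) ∧ (∀ g : EuclideanSpace ℝ (Fin 3) ≃ₗᵢ[ℝ] EuclideanSpace ℝ (Fin 3), Literature.Analysis.FluidPDE.IsOctahedralIsometry g → LinearMap.det (g.toLinearEquiv : EuclideanSpace ℝ (Fin 3) →ₗ[ℝ] EuclideanSpace ℝ (Fin 3)) = 1 → ∀ x : EuclideanSpace ℝ (Fin 3), h (g x) = g (h x) ∧ P (g x) = P x) ∧ (∀ s : Set (EuclideanSpace ℝ (Fin 3)), IsOpen s → s.Nonempty → ∃ x ∈ s, x ≠ 0 ∧ h x ≠ 0)) → ∃ (Q : EuclideanSpace ℝ (Fin 3) → EuclideanSpace ℝ (Fin 3)) (Φ : EuclideanSpace ℝ (Fin 3) → ℝ), ContDiff ℝ (⊤ : ℕ∞) Q ∧ ContDiff ℝ (⊤ : ℕ∞) Φ ∧ Literature.Analysis.FluidPDE.VectorCalculus.IsDivFree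 Q ∧ (∀ y : EuclideanSpace ℝ (Fin 3), Literature.Analysis.FluidPDE.convect Q Q y + gradient Φ y = 0) ∧ (∀ g : EuclideanSpace ℝ (Fin 3) ≃ₗᵢ[ℝ] EuclideanSpace ℝ (Fin 3), Literature.Analysis.FluidPDE.IsOctahedralIsometry g → LinearMap.det (g.toLinearEquiv : EuclideanSpace ℝ (Fin 3) →ₗ[ℝ] EuclideanSpace ℝ (Fin 3)) = 1 → ∀ y : EuclideanSpace ℝ (Fin 3), Q (g y) = g (Q y) ∧ Φ (g y) = Φ y) ∧ (∀ s : Set (EuclideanSpace ℝ (Fin 3)), IsOpen s → s.Nonempty → ∃ y ∈ s, Q y ≠ 0) ∧ (∃ C δ : ℝ, 0 < δ ∧ ∀ y : EuclideanSpace ℝ (Fin 3), 1 ≤ ‖y‖ → ‖Q y - h y‖ + ‖y‖ * ‖fderiv ℝ Q y - fderiv ℝ h y‖ ≤ C * ‖y‖ ^ (-a - δ)) := by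
  sorry

/-- **S2 `stub_corrector` — CORRECT BY SELECTION: a resolved skeleton ⇒ a collapse-compatible resolved skeleton**
(size XL; open problem in kind; the load-bearing stub). For all `(a, l₀, h, P)` satisfying the admissible-cone
clauses (as in S1) and all `(Q, Φ)` satisfying the resolution clauses for that cone (as in the conclusion of S1):
`CollapsingResolver` — some admissible cone `(a', l₀', h', P')`, some resolution `(Q', Φ')` of it, and a collapse
corrector `b < 0`, `C^∞` divergence-free `W`, `C^∞` `q` with
`(Q'·∇)W + (W·∇)Q' + ∇q = ΔQ' + b(a'Q' + (DQ')y)` on `ℝ³`. Equivalently: if the class of resolved skeletons is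
nonempty, it contains a collapse-compatible member. Why plausibly true (the route's mechanism): along the
steady-Euler scaling subgroup `Q ↦ λ^(−a)Q(·/λ)` the `O(1/Re)` equation of quasi-static shrinking is the LINEAR
corrector equation (★★) with `b = λλ̇/ν`; its solvability conditions live on the compact Bernoulli tori of `Q`
(cokernel `f(B_Q)Q`, `g(B_Q)curl Q` by Arnold's structure theorem plus hyperbolic axis chains) and say that
viscous energy loss and flux change per torus equal those of self-similar shrinking — two families of profile
conditions that a resolution with free Bernoulli/vorticity profile data (the non-isolated families of Grad's
picture, arXiv:2007.09103 p.7) can be tuned to meet, Kelvin's theorem plus viscosity then forcing `b < 0`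
(collapse, `γ = 1/2`) for `a > 1`. Why it might fail: the per-torus energy and flux laws may clash in sign and
force `b > 0` (the 2-D shadow is the expanding Oseen vortex), or their core-line limit
`∮ t̂·(ΔQ + b(aQ + (y·∇)Q)) = 0` may contradict the local normal form of steady Euler at an elliptic closed line
(the route's CHEAPEST FALSIFIER); resolutions may be isolated (no profile freedom to tune: Grad's conjecture);
hyperbolic chains may carry a Friedlander–Vishik-type unsolvable component. Sources: ArnoldKhesin1998 (Ch. II
§1, structure of 3-D steady flows), arXiv:2007.09103 (Conj. 1, §1.2), arXiv:2606.13462, Gavrilov2019,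
Summits/NavierStokesRegularity/NavierStokesRegularity/Cruxes/CorrectorSolvable/KillMemo-stokes-carleman.md (§4,
successor object 2b), negatives stmt-NavierStokesRegularity-1429 (what the compact-support version died of). -/
theorem stub_corrector :
    ∀ (a l₀ : ℝ) (h : EuclideanSpace ℝ (Fin 3) → EuclideanSpace ℝ (Fin 3)) (P : EuclideanSpace ℝ (Fin 3) → ℝ) (Q : EuclideanSpace ℝ (Fin 3) → EuclideanSpace ℝ (Fin 3)) (Φ : EuclideanSpace ℝ (Fin 3) → ℝ), (1 < a ∧ a < 3 / 2 ∧ 1 < l₀ ∧ ContDiffOn ℝ 1 h {x : EuclideanSpace ℝ (Fin 3) | x ≠ 0} ∧ ContDiffOn ℝ 1 P {x : EuclideanSpace ℝ (Fin 3) | x ≠ 0} ∧ (∀ x : EuclideanSpace ℝ (Fin 3), x ≠ 0 → h (l₀ • x) = (l₀ ^ (-a)) • h x) ∧ (∀ x : EuclideanSpace ℝ (Fin 3), x ≠ 0 → P (l₀ • x) = l₀ ^ (-(2 * a)) * P x) ∧ (∀ x : EuclideanSpace ℝ (Fin 3), x ≠ 0 → Literature.Analysis.FluidPDE.VectorCalculus.divergence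 h x = 0) ∧ (∀ x : EuclideanSpace ℝ (Fin 3), x ≠ 0 → Literature.Analysis.FluidPDE.convect h h x + gradient P x = 0) ∧ (∀ g : EuclideanSpace ℝ (Fin 3) ≃ₗᵢ[ℝ] EuclideanSpace ℝ (Fin 3), Literature.Analysis.FluidPDE.IsOctahedralIsometry g → LinearMap.det (g.toLinearEquiv : EuclideanSpace ℝ (Fin 3) →ₗ[ℝ] EuclideanSpace ℝ (Fin 3)) = 1 → ∀ x : EuclideanSpace ℝ (Fin 3), h (g x) = g (h x) ∧ P (g x) = P x) ∧ (∀ s : Set (EuclideanSpace ℝ (Fin 3)), IsOpen s → s.Nonempty → ∃ x ∈ s, x ≠ 0 ∧ h x ≠ 0)) → (ContDiff ℝ (⊤ : ℕ∞) Q ∧ ContDiff ℝ (⊤ : ℕ∞) Φ ∧ Literature.Analysis.FluidPDE.VectorCalculus.IsDivFree Q ∧ (∀ y : EuclideanSpace ℝ (Fin 3), Literature.Analysis.FluidPDE.convect Q Q y + gradient Φ y = 0) ∧ (∀ g : EuclideanSpace ℝ (Fin 3) ≃ₗᵢ[ℝ] EuclideanSpace ℝ (Fin 3), Literature.Analysis.FluidPDE.IsOctahedralIsometry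 g → LinearMap.det (g.toLinearEquiv : EuclideanSpace ℝ (Fin 3) →ₗ[ℝ] EuclideanSpace ℝ (Fin 3)) = 1 → ∀ y : EuclideanSpace ℝ (Fin 3), Q (g y) = g (Q y) ∧ Φ (g y) = Φ y) ∧ (∀ s : Set (EuclideanSpace ℝ (Fin 3)), IsOpen s → s.Nonempty → ∃ y ∈ s, Q y ≠ 0) ∧ (∃ C δ : ℝ, 0 < δ ∧ ∀ y : EuclideanSpace ℝ (Fin 3), 1 ≤ ‖y‖ → ‖Q y - h y‖ + ‖y‖ * ‖fderiv ℝ Q y - fderiv ℝ h y‖ ≤ C * ‖y‖ ^ (-a - δ))) → Summit.NavierStokesRegularity.NavierStokesRegularity.Theses.ConeTipCollapse.CollapsingResolver := by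
  sorry

/-! ### Name-keyed aliases of the two stub statements — the hypotheses of `ConeToResolver_of`

The native skeleton audit (`#h21_check_skeleton`, run by `ledger skeleton check`) admits a `Prop` hypothesis of
the composing theorem only if its head constant is a registered obligation or is NAMED like a declared stub;
`__Registered.stub_X` is the statement of `stub_X` verbatim under the stub's short name (tree convention, e.g.
`Cruxes/SubBallisticLiouville/Lines/birth.lean`). Each alias is an `abbrev`, definitionally (and textually) its
stub's signature; the wiring `example` at the end checks this. -/
namespace __Registered

/-- Alias of the statement of `stub_desing` (every admissible cone admits an equivariant smooth resolution), keyed by the stub name. -/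
abbrev stub_desing : Prop :=
  ∀ (a l₀ : ℝ) (h : EuclideanSpace ℝ (Fin 3) → EuclideanSpace ℝ (Fin 3)) (P : EuclideanSpace ℝ (Fin 3) → ℝ), (1 < a ∧ a < 3 / 2 ∧ 1 < l₀ ∧ ContDiffOn ℝ 1 h {x : EuclideanSpace ℝ (Fin 3) | x ≠ 0} ∧ ContDiffOn ℝ 1 P {x : EuclideanSpace ℝ (Fin 3) | x ≠ 0} ∧ (∀ x : EuclideanSpace ℝ (Fin 3), x ≠ 0 → h (l₀ • x) = (l₀ ^ (-a)) • h x) ∧ (∀ x : EuclideanSpace ℝ (Fin 3), x ≠ 0 → P (l₀ • x) = l₀ ^ (-(2 * a)) * P x) ∧ (∀ x : EuclideanSpace ℝ (Fin 3), x ≠ 0 → Literature.Analysis.FluidPDE.VectorCalculus.divergence h x = 0) ∧ (∀ x : EuclideanSpace ℝ (Fin 3), x ≠ 0 → Literature.Analysis.FluidPDE.convect h h x + gradient P x = 0) ∧ (∀ g : EuclideanSpace ℝ (Fin 3) ≃ₗᵢ[ℝ] EuclideanSpace ℝ (Fin 3), Literature.Analysis.FluidPDE.IsOctahedralIsometry g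 → LinearMap.det (g.toLinearEquiv : EuclideanSpace ℝ (Fin 3) →ₗ[ℝ] EuclideanSpace ℝ (Fin 3)) = 1 → ∀ x : EuclideanSpace ℝ (Fin 3), h (g x) = g (h x) ∧ P (g x) = P x) ∧ (∀ s : Set (EuclideanSpace ℝ (Fin 3)), IsOpen s → s.Nonempty → ∃ x ∈ s, x ≠ 0 ∧ h x ≠ 0)) → ∃ (Q : EuclideanSpace ℝ (Fin 3) → EuclideanSpace ℝ (Fin 3)) (Φ : EuclideanSpace ℝ (Fin 3) → ℝ), ContDiff ℝ (⊤ : ℕ∞) Q ∧ ContDiff ℝ (⊤ : ℕ∞) Φ ∧ Literature.Analysis.FluidPDE.VectorCalculus.IsDivFree Q ∧ (∀ y : EuclideanSpace ℝ (Fin 3), Literature.Analysis.FluidPDE.convect Q Q y + gradient Φ y = 0) ∧ (∀ g : EuclideanSpace ℝ (Fin 3) ≃ₗᵢ[ℝ] EuclideanSpace ℝ (Fin 3), Literature.Analysis.FluidPDE.IsOctahedralIsometry g → LinearMap.det (g.toLinearEquiv : EuclideanSpace ℝ (Fin 3) →ₗ[ℝ] EuclideanSpace ℝ (Fin 3)) =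 1 → ∀ y : EuclideanSpace ℝ (Fin 3), Q (g y) = g (Q y) ∧ Φ (g y) = Φ y) ∧ (∀ s : Set (EuclideanSpace ℝ (Fin 3)), IsOpen s → s.Nonempty → ∃ y ∈ s, Q y ≠ 0) ∧ (∃ C δ : ℝ, 0 < δ ∧ ∀ y : EuclideanSpace ℝ (Fin 3), 1 ≤ ‖y‖ → ‖Q y - h y‖ + ‖y‖ * ‖fderiv ℝ Q y - fderiv ℝ h y‖ ≤ C * ‖y‖ ^ (-a - δ))

/-- Alias of the statement of `stub_corrector` (a resolved admissible skeleton ⇒ `CollapsingResolver`), keyed by the stub name. -/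
abbrev stub_corrector : Prop :=
  ∀ (a l₀ : ℝ) (h : EuclideanSpace ℝ (Fin 3) → EuclideanSpace ℝ (Fin 3)) (P : EuclideanSpace ℝ (Fin 3) → ℝ) (Q : EuclideanSpace ℝ (Fin 3) → EuclideanSpace ℝ (Fin 3)) (Φ : EuclideanSpace ℝ (Fin 3) → ℝ), (1 < a ∧ a < 3 / 2 ∧ 1 < l₀ ∧ ContDiffOn ℝ 1 h {x : EuclideanSpace ℝ (Fin 3) | x ≠ 0} ∧ ContDiffOn ℝ 1 P {x : EuclideanSpace ℝ (Fin 3) | x ≠ 0} ∧ (∀ x : EuclideanSpace ℝ (Fin 3), x ≠ 0 → h (l₀ • x) = (l₀ ^ (-a)) • h x) ∧ (∀ x : EuclideanSpace ℝ (Fin 3), x ≠ 0 → P (l₀ • x) = l₀ ^ (-(2 * a)) * P x) ∧ (∀ x : EuclideanSpace ℝ (Fin 3), x ≠ 0 → Literature.Analysis.FluidPDE.VectorCalculus.divergence h x = 0) ∧ (∀ x : EuclideanSpace ℝ (Fin 3), x ≠ 0 → Literature.Analysis.FluidPDE.convect h h x + gradient P x = 0) ∧ (∀ g : EuclideanSpace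 ℝ (Fin 3) ≃ₗᵢ[ℝ] EuclideanSpace ℝ (Fin 3), Literature.Analysis.FluidPDE.IsOctahedralIsometry g → LinearMap.det (g.toLinearEquiv : EuclideanSpace ℝ (Fin 3) →ₗ[ℝ] EuclideanSpace ℝ (Fin 3)) = 1 → ∀ x : EuclideanSpace ℝ (Fin 3), h (g x) = g (h x) ∧ P (g x) = P x) ∧ (∀ s : Set (EuclideanSpace ℝ (Fin 3)), IsOpen s → s.Nonempty → ∃ x ∈ s, x ≠ 0 ∧ h x ≠ 0)) → (ContDiff ℝ (⊤ : ℕ∞) Q ∧ ContDiff ℝ (⊤ : ℕ∞) Φ ∧ Literature.Analysis.FluidPDE.VectorCalculus.IsDivFree Q ∧ (∀ y : EuclideanSpace ℝ (Fin 3), Literature.Analysis.FluidPDE.convect Q Q y + gradient Φ y = 0) ∧ (∀ g : EuclideanSpace ℝ (Fin 3) ≃ₗᵢ[ℝ] EuclideanSpace ℝ (Fin 3), Literature.Analysis.FluidPDE.IsOctahedralIsometry g → LinearMap.det (g.toLinearEquiv : EuclideanSpace ℝ (Fin 3) →ₗ[ℝ] EuclideanSpace ℝ (Fin 3)) = 1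 → ∀ y : EuclideanSpace ℝ (Fin 3), Q (g y) = g (Q y) ∧ Φ (g y) = Φ y) ∧ (∀ s : Set (EuclideanSpace ℝ (Fin 3)), IsOpen s → s.Nonempty → ∃ y ∈ s, Q y ≠ 0) ∧ (∃ C δ : ℝ, 0 < δ ∧ ∀ y : EuclideanSpace ℝ (Fin 3), 1 ≤ ‖y‖ → ‖Q y - h y‖ + ‖y‖ * ‖fderiv ℝ Q y - fderiv ℝ h y‖ ≤ C * ‖y‖ ^ (-a - δ))) → Summit.NavierStokesRegularity.NavierStokesRegularity.Theses.ConeTipCollapse.CollapsingResolver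

end __Registered

/-! ### The composition (kernel-checked, sorry-free): S1 → S2 → the crux, BY NAME -/

/-- **`ConeToResolver` from the two stub statements.** Given `InteractingLogPeriodicCone`, take its admissible
cone `(a, l₀, h, P)`; S1 resolves it by some `(Q, Φ)`; S2, applied to this resolved skeleton, returns
`CollapsingResolver`. [folklore] -/
theorem ConeToResolver_of :
    __Registered.stub_desing → __Registered.stub_corrector →
      Summit.NavierStokesRegularity.NavierStokesRegularity.Theses.ConeTipCollapse.ConeToResolver := by
  intro hS1 hS2 hcone
  obtain ⟨a, l₀, h, P, hadm⟩ := hcone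
  obtain ⟨Q, Φ, hres⟩ := hS1 a l₀ h P hadm
  exact hS2 a l₀ h P Q Φ hadm hres

/-- WIRING CHECK: the two sorried stubs compose to a closed term of the crux's type (modulo their `sorry`s), so
each stub's explicit signature is literally its `__Registered` alias. Deliberately an `example` — no constant of
type `ConeToResolver` enters the environment. -/
example : Summit.NavierStokesRegularity.NavierStokesRegularity.Theses.ConeTipCollapse.ConeToResolver :=
  ConeToResolver_of stub_desing stub_corrector

end Summit.NavierStokesRegularity.NavierStokesRegularity.Cruxes.ConeToResolver.Birth
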